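import Mathlib
import Summits.Ventures.PercRepro2.UniversalClosures

/-! # The universal Hall statement (UH*) survives the doubling of a leaf in the critical context
(seat mine-b, cell pub-perc-repro2; MINE-B.md §22.1–22.2)

Part A — the **φ-formulation** of (UH*): on a finite labelled preorder `(Z, R, B)`, if for every monotone
`φ : Z → ℕ∞` the signed count `Σ_z ([R z = 1 ∧ φ z ≤ B z + 1] − B z·[R z = 0 ∧ φ z ≤ B z])` is non-negative,
then `Universal R B` holds (`universal_of_phi`).  Proof: Hall's condition for a set `s` of slots, with
`φ z := inf {B (source p) : p ∈ s, z ≤ source p}` — the admissible targets of `s` are exactly the `z` with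
`R z = 1 ∧ φ z ≤ B z + 1`, and every source of `s` has `φ ≤ B`.

Part B — the **doubling theorem**: for `X` carrying `G_1` (= DownDom), `V2_2` and the level-1 Harris
inequality, the series product `X ∧ B₂` with the bundle of two parallel free edges (labels
`(min (r x) (rB2 y), min (b x) (bB2 y))`, `rB2 = 2 − |y|`, `bB2 = |y|`) satisfies (UH*)
(`universal_doubling`).  The certificate is a pointwise inequality between the φ-weight and a sum of
statements of `X` applied to the slices `{x : φ (x, y) ≤ m}` of the fibres (lower sets of `X`) plus
containments `[φ (x, y') ≤ m] − [φ (x, y) ≤ m] ≥ 0` for `y' ≤ y`: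
`G_1` on the fibre `∅` at level 1, `V2_2` on the fibre `{2}` at level 2, the Harris weight on the fibres
`{1}`, `{2}` at level 1 — a blue-level-stratified relay (see §22.2). -/

namespace Summit.Ventures.PercRepro2.UHClosure

open Finset

/-! ### Part A: (UH*) from the φ-inequality -/

section phi

variable {Z : Type*} [Preorder Z] [Fintype Z] (R B : Z → ℕ)

/-- the φ-weight of a point at the value `m`: `+1` for a target counted at `m` (`R = 1`, `m ≤ B + 1`),
`−B` for a source counted at `m` (`R = 0`, `m ≤ B`) -/
def uw (z : Z) (m : ℕ∞) : ℤ :=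
  (if R z = 1 ∧ m ≤ (B z : ℕ∞) + 1 then 1 else 0) - (if R z = 0 ∧ m ≤ (B z : ℕ∞) then (B z : ℤ) else 0)

/-- the **φ-inequality**: every monotone `φ` has non-negative total φ-weight -/
def PhiIneq : Prop := ∀ φ : Z → ℕ∞, Monotone φ → 0 ≤ ∑ z, uw R B z (φ z)

variable [DecidableEq Z] [DecidableRel (α := Z) (· ≤ ·)]

/-- the admissible targets of a slot of (UH*) -/
def utargets (p : SlotL (USrc R B) B) : Finset Z :=
  univ.filter (fun z => z ≤ p.1.1.1 ∧ R z = 1 ∧ B p.1.1.1 ≤ B z + 1)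

/-- the level function of a set of slots: the least source level above `z` -/
noncomputable def phiOf (s : Finset (SlotL (USrc R B) B)) (z : Z) : ℕ∞ :=
  (s.filter (fun p => z ≤ p.1.1.1)).inf (fun p => (B p.1.1.1 : ℕ∞))

omit [DecidableEq Z] in
/-- the level function is monotone: a lower point sees at least the sources above a higher one -/
lemma phiOf_mono (s : Finset (SlotL (USrc R B) B)) : Monotone (phiOf R B s) := by
  intro z z' hzz'
  unfold phiOf
  apply Finset.inf_mono
  intro p hp
  simp only [mem_filter] at hp ⊢
  exact ⟨hp.1, hzz'.trans hp.2⟩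

omit [DecidableEq Z] in
/-- the level function is at most the level of any slot source above the point -/
lemma phiOf_le (s : Finset (SlotL (USrc R B) B)) {z : Z} {p : SlotL (USrc R B) B} (hp : p ∈ s)
    (hz : z ≤ p.1.1.1) : phiOf R B s z ≤ (B p.1.1.1 : ℕ∞) := by
  unfold phiOf
  exact Finset.inf_le (by simp only [mem_filter]; exact ⟨hp, hz⟩)

/-- the targets of a set of slots are exactly the points counted as targets by `phiOf` -/
lemma biUnion_utargets (s : Finset (SlotL (USrc R B) B)) :
    s.biUnion (utargets R B) = univ.filter (fun z => R z = 1 ∧ phiOf R B s z ≤ (B z : ℕ∞) + 1) := by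
  ext z
  simp only [mem_biUnion, utargets, mem_filter, mem_univ, true_and]
  constructor
  · rintro ⟨p, hp, hle, hR, hB⟩
    refine ⟨hR, (phiOf_le R B s hp hle).trans ?_⟩
    exact_mod_cast hB
  · rintro ⟨hR, hφ⟩
    have h := (Finset.inf_le_iff (f := fun p : SlotL (USrc R B) B => (B p.1.1.1 : ℕ∞))
      (s := s.filter (fun p => z ≤ p.1.1.1)) (a := (B z : ℕ∞) + 1) (by
        exact lt_of_lt_of_le (WithTop.coe_lt_top _) le_rfl)).1 hφ
    obtain ⟨p, hp, hle⟩ := h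
    simp only [mem_filter] at hp
    refine ⟨p, hp.1, hp.2, hR, ?_⟩
    have : ((B p.1.1.1 : ℕ) : ℕ∞) ≤ ((B z + 1 : ℕ) : ℕ∞) := by push_cast; exact hle
    exact_mod_cast this

omit [DecidableEq Z] in
/-- every source of a slot of `s` is counted as a source by `phiOf` -/
lemma phiOf_src_le (s : Finset (SlotL (USrc R B) B)) {p : SlotL (USrc R B) B} (hp : p ∈ s) :
    phiOf R B s p.1.1.1 ≤ (B p.1.1.1 : ℕ∞) :=
  phiOf_le R B s hp le_rfl

/-- the source weight counted by `phiOf` -/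
noncomputable def uws (s : Finset (SlotL (USrc R B) B)) (z : Z) : ℤ :=
  if R z = 0 ∧ phiOf R B s z ≤ (B z : ℕ∞) then (B z : ℤ) else 0

omit [DecidableEq Z] in
/-- the counted source weight is non-negative -/
lemma uws_nonneg (s : Finset (SlotL (USrc R B) B)) (z : Z) : 0 ≤ uws R B s z := by
  unfold uws; split_ifs <;> simp

/-- the slots of `s` are at most the source weight counted by `phiOf` -/
lemma card_slots_le_uws (s : Finset (SlotL (USrc R B) B)) :
    (s.card : ℤ) ≤ ∑ z, uws R B s z := by
  have h1 := card_slotsL_le (USrc R B) B s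
  have h2 : ∑ x ∈ s.image (fun p => p.1.1), (B x.1 : ℤ)
      = ∑ z ∈ (s.image (fun p => p.1.1)).map ⟨Subtype.val, Subtype.val_injective⟩, uws R B s z := by
    rw [Finset.sum_map]
    apply Finset.sum_congr rfl
    intro x hx
    simp only [mem_image] at hx
    obtain ⟨p, hp, hpx⟩ := hx
    have hsrc : phiOf R B s x.1 ≤ (B x.1 : ℕ∞) := by rw [← hpx]; exact phiOf_src_le R B s hp
    simp only [Function.Embedding.coeFn_mk, uws, x.2.1.1, hsrc, and_self, if_true]
  have h3 : ∑ z ∈ (s.image (fun p => p.1.1)).map ⟨Subtype.val, Subtype.val_injective⟩, uws R B s z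
      ≤ ∑ z, uws R B s z :=
    Finset.sum_le_sum_of_subset_of_nonneg (subset_univ _) (fun z _ _ => uws_nonneg R B s z)
  linarith

/-- **Hall's condition for (UH*) from the φ-inequality** -/
lemma hall_condition_of_phi (h : PhiIneq R B) (s : Finset (SlotL (USrc R B) B)) :
    s.card ≤ (s.biUnion (utargets R B)).card := by
  have hφ := h (phiOf R B s) (phiOf_mono R B s)
  have hsplit : ∑ z, uw R B z (phiOf R B s z)
      = ∑ z, (if R z = 1 ∧ phiOf R B s z ≤ (B z : ℕ∞) + 1 then (1 : ℤ) else 0) - ∑ z, uws R B s z := by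
    rw [← Finset.sum_sub_distrib]
    exact Finset.sum_congr rfl (fun z _ => rfl)
  have hT : ∑ z, (if R z = 1 ∧ phiOf R B s z ≤ (B z : ℕ∞) + 1 then (1 : ℤ) else 0)
      = ((s.biUnion (utargets R B)).card : ℤ) := by
    rw [biUnion_utargets, Finset.card_filter]
    push_cast
    rfl
  have h1 := card_slots_le_uws R B s
  have : (s.card : ℤ) ≤ ((s.biUnion (utargets R B)).card : ℤ) := by linarith
  exact_mod_cast this

/-- **(UH*) from the φ-inequality** -/
theorem universal_of_phi (h : PhiIneq R B) : Universal R B := by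
  obtain ⟨f, hf, hmem⟩ := (Finset.all_card_le_biUnion_card_iff_exists_injective (utargets R B)).1
    (hall_condition_of_phi R B h)
  refine ⟨f, hf, fun p => ?_⟩
  have := hmem p
  simp only [utargets, mem_filter, mem_univ, true_and] at this
  exact this

end phi

/-! ### Part B: the doubling theorem -/

section doubling

variable {X : Type*} [Preorder X] [Fintype X] (r b : X → ℕ)

/-- the bundle of two parallel free edges: a pair of booleans (`true` = the edge is blue) -/
abbrev B2 := Bool × Bool
/-- the red label of the bundle: the number of red edges -/
def rB2 (y : B2) : ℕ := (if y.1 then 0 else 1) + (if y.2 then 0 else 1)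
/-- the blue label of the bundle: the number of blue edges -/
def bB2 (y : B2) : ℕ := (if y.1 then 1 else 0) + (if y.2 then 1 else 0)
/-- the red label of the series product `X ∧ B₂` -/
abbrev dR : X × B2 → ℕ := fun p => min (r p.1) (rB2 p.2)
/-- the blue label of the series product `X ∧ B₂` -/
abbrev dB : X × B2 → ℕ := fun p => min (b p.1) (bB2 p.2)

/-- the level-1 Harris weight `[r ≥ 1] − [b ≥ 1]` -/
def hwOne (a c : ℕ) : ℤ := (if 1 ≤ a then 1 else 0) - (if 1 ≤ c then 1 else 0)

omit [Fintype X] in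
/-- the level-1 Harris inequality as a lower-set statement -/
lemma sum_hwOne_nonneg (h : LevelHarris r b) (D : Finset X) (hD : IsLowerSet (↑D : Set X)) :
    0 ≤ ∑ x ∈ D, hwOne (r x) (b x) := by
  have := h D hD 1
  have e : ∑ x ∈ D, hwOne (r x) (b x)
      = ((D.filter (fun x => 1 ≤ r x)).card : ℤ) - ((D.filter (fun x => 1 ≤ b x)).card : ℤ) := by
    unfold hwOne
    rw [Finset.sum_sub_distrib, Finset.card_filter, Finset.card_filter]; push_cast; rfl
  rw [e]
  have : ((D.filter (fun x => 1 ≤ b x)).card : ℤ) ≤ ((D.filter (fun x => 1 ≤ r x)).card : ℤ) := by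
    exact_mod_cast this
  linarith

/-- indicator of a condition -/
def indL (p : Prop) [Decidable p] : ℤ := if p then 1 else 0

/-- the containment multipliers of the certificate (by the label `(a, c)` of the `X`-coordinate) -/
def mu1 (a c : ℕ) : ℤ := if a = 0 ∧ c = 1 then 1 else 0
/-- multiplier of the containment `yB ≤ yt` at level 2 -/
def mu2 (a c : ℕ) : ℤ := if a = 0 ∧ 2 ≤ c then 2 else 0
/-- multiplier of the containment `yA ≤ yt` at level 1 -/
def mu3 (a c : ℕ) : ℤ := if 1 ≤ a ∧ c = 1 then 1 else 0
/-- multiplier of the containments `yA ≤ yt`, `yB ≤ yt` at level 2 -/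
def mu4 (a c : ℕ) : ℤ := if 1 ≤ a ∧ 2 ≤ c then 1 else 0

/-- the four fibres: `yo = ∅` (two red edges), `yA`, `yB` (one blue edge), `yt` (two blue edges) -/
abbrev yo : B2 := (false, false)
/-- the fibre with the first edge blue -/
abbrev yA : B2 := (true, false)
/-- the fibre with the second edge blue -/
abbrev yB : B2 := (false, true)
/-- the top fibre (both edges blue) -/
abbrev yt : B2 := (true, true)

/-- the statement part of the certificate at the point `(x, y)` with `φ = m`:
`G_1` on fibre `∅` at level 1, `V2_2` on fibre `yB` at level 2, Harris on fibres `yA`, `yB` at level 1 -/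
noncomputable def certS (a c : ℕ) (y : B2) (m : ℕ∞) : ℤ :=
  (if y = yo ∧ m ≤ 1 then gw 1 a c else 0) + (if y = yB ∧ m ≤ 2 then vw 2 a c else 0)
    + (if y = yA ∧ m ≤ 1 then hwOne a c else 0) + (if y = yB ∧ m ≤ 1 then hwOne a c else 0)

/-- the containment part of the certificate -/
noncomputable def certC (a c : ℕ) (y : B2) (m : ℕ∞) : ℤ :=
  mu1 a c * (indL (y = yo ∧ m ≤ 1) - indL (y = yt ∧ m ≤ 1))
    + mu2 a c * (indL (y = yB ∧ m ≤ 2) - indL (y = yt ∧ m ≤ 2))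
    + mu3 a c * (indL (y = yA ∧ m ≤ 1) - indL (y = yt ∧ m ≤ 1))
    + mu4 a c * (indL (y = yA ∧ m ≤ 2) + indL (y = yB ∧ m ≤ 2) - 2 * indL (y = yt ∧ m ≤ 2))

/-- the statement part at a natural value -/
def certS' (a c : ℕ) (y : B2) (n : ℕ) : ℤ :=
  (if y = yo ∧ n ≤ 1 then gw 1 a c else 0) + (if y = yB ∧ n ≤ 2 then vw 2 a c else 0)
    + (if y = yA ∧ n ≤ 1 then hwOne a c else 0) + (if y = yB ∧ n ≤ 1 then hwOne a c else 0)

/-- the containment part at a natural value -/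
def certC' (a c : ℕ) (y : B2) (n : ℕ) : ℤ :=
  mu1 a c * (indL (y = yo ∧ n ≤ 1) - indL (y = yt ∧ n ≤ 1))
    + mu2 a c * (indL (y = yB ∧ n ≤ 2) - indL (y = yt ∧ n ≤ 2))
    + mu3 a c * (indL (y = yA ∧ n ≤ 1) - indL (y = yt ∧ n ≤ 1))
    + mu4 a c * (indL (y = yA ∧ n ≤ 2) + indL (y = yB ∧ n ≤ 2) - 2 * indL (y = yt ∧ n ≤ 2))

/-- the φ-weight of the product at labels `(a, c)`, fibre `y`, natural value `n` -/
def dw' (a c : ℕ) (y : B2) (n : ℕ) : ℤ :=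
  (if min a (rB2 y) = 1 ∧ n ≤ min c (bB2 y) + 1 then 1 else 0)
    - (if min a (rB2 y) = 0 ∧ n ≤ min c (bB2 y) then ((min c (bB2 y) : ℕ) : ℤ) else 0)

/-- the statement part vanishes at `⊤` -/
lemma certS_top (a c : ℕ) (y : B2) : certS a c y ⊤ = 0 := by simp [certS]
/-- the containment part vanishes at `⊤` -/
lemma certC_top (a c : ℕ) (y : B2) : certC a c y ⊤ = 0 := by simp [certC, indL]
/-- the statement part at a natural value -/
lemma certS_coe (a c : ℕ) (y : B2) (n : ℕ) : certS a c y (n : ℕ∞) = certS' a c y n := by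
  have h1 : ((n : ℕ∞) ≤ 1) ↔ n ≤ 1 := by exact_mod_cast Iff.rfl
  have h2 : ((n : ℕ∞) ≤ 2) ↔ n ≤ 2 := by exact_mod_cast Iff.rfl
  simp only [certS, certS', h1, h2]
/-- the containment part at a natural value -/
lemma certC_coe (a c : ℕ) (y : B2) (n : ℕ) : certC a c y (n : ℕ∞) = certC' a c y n := by
  have h1 : ((n : ℕ∞) ≤ 1) ↔ n ≤ 1 := by exact_mod_cast Iff.rfl
  have h2 : ((n : ℕ∞) ≤ 2) ↔ n ≤ 2 := by exact_mod_cast Iff.rfl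
  simp only [certC, certC', h1, h2]

omit [Preorder X] [Fintype X] in
/-- the φ-weight vanishes at `⊤` -/
lemma uw_top (z : X × B2) : uw (dR r) (dB b) z ⊤ = 0 := by simp [uw]

omit [Preorder X] [Fintype X] in
/-- the φ-weight of the product at a natural value, in terms of the labels -/
lemma uw_coe (z : X × B2) (n : ℕ) : uw (dR r) (dB b) z (n : ℕ∞) = dw' (r z.1) (b z.1) z.2 n := by
  have h1 : ∀ k : ℕ, ((n : ℕ∞) ≤ (k : ℕ∞) + 1) ↔ n ≤ k + 1 := fun k => by exact_mod_cast Iff.rfl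
  have h2 : ∀ k : ℕ, ((n : ℕ∞) ≤ (k : ℕ∞)) ↔ n ≤ k := fun k => by exact_mod_cast Iff.rfl
  simp only [uw, dw', dR, dB, h1, h2]

/-- the pointwise certificate on the fibre `yo` -/
lemma cert_le_yo (a c n : ℕ) : certS' a c yo n + certC' a c yo n ≤ dw' a c yo n := by
  simp only [certS', certC', dw', indL, mu1, mu2, mu3, mu4, hwOne, gw, vw, rB2, bB2, yo, yA, yB, yt,
    Prod.mk.injEq, Bool.false_eq_true, and_self, and_false, false_and, true_and,
    if_false]
  split_ifs <;> omega

/-- the pointwise certificate on the fibre `yA` -/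
lemma cert_le_yA (a c n : ℕ) : certS' a c yA n + certC' a c yA n ≤ dw' a c yA n := by
  simp only [certS', certC', dw', indL, mu1, mu2, mu3, mu4, hwOne, gw, vw, rB2, bB2, yo, yA, yB, yt,
    Prod.mk.injEq, Bool.false_eq_true, Bool.true_eq_false, and_self, and_false, false_and, true_and,
    if_true, if_false]
  split_ifs <;> omega

/-- the pointwise certificate on the fibre `yB` -/
lemma cert_le_yB (a c n : ℕ) : certS' a c yB n + certC' a c yB n ≤ dw' a c yB n := by
  simp only [certS', certC', dw', indL, mu1, mu2, mu3, mu4, hwOne, gw, vw, rB2, bB2, yo, yA, yB, yt,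
    Prod.mk.injEq, Bool.false_eq_true, Bool.true_eq_false, and_self, and_false, false_and, true_and,
    if_true, if_false]
  split_ifs <;> omega

/-- the pointwise certificate on the fibre `yt` -/
lemma cert_le_yt (a c n : ℕ) : certS' a c yt n + certC' a c yt n ≤ dw' a c yt n := by
  simp only [certS', certC', dw', indL, mu1, mu2, mu3, mu4, hwOne, gw, vw, rB2, bB2, yo, yA, yB, yt,
    Prod.mk.injEq, Bool.true_eq_false, and_self, and_false, false_and, true_and,
    if_true, if_false]
  split_ifs <;> omega

/-- **the pointwise certificate** at natural values -/
lemma cert_le' (a c : ℕ) (y : B2) (n : ℕ) : certS' a c y n + certC' a c y n ≤ dw' a c y n := by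
  rcases y with ⟨y1, y2⟩
  cases y1 <;> cases y2
  · exact cert_le_yo a c n
  · exact cert_le_yB a c n
  · exact cert_le_yA a c n
  · exact cert_le_yt a c n

omit [Preorder X] [Fintype X] in
/-- **the pointwise certificate** -/
lemma cert_le (z : X × B2) (m : ℕ∞) :
    certS (r z.1) (b z.1) z.2 m + certC (r z.1) (b z.1) z.2 m ≤ uw (dR r) (dB b) z m := by
  induction m using ENat.recTopCoe with
  | top => rw [certS_top, certC_top, uw_top]; exact le_rfl
  | coe n => rw [certS_coe, certC_coe, uw_coe]; exact cert_le' _ _ _ _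

/-- a slice of a fibre is a lower set of `X` -/
lemma slice_isLowerSet (φ : X × B2 → ℕ∞) (hφ : Monotone φ) (y : B2) (m : ℕ∞) :
    IsLowerSet (↑(univ.filter (fun x : X => φ (x, y) ≤ m)) : Set X) := by
  intro x x' hle hx
  simp only [coe_filter, mem_univ, true_and, Set.mem_setOf_eq] at hx ⊢
  exact (hφ (Prod.mk_le_mk.2 ⟨hle, le_rfl⟩)).trans hx

/-- a lower-set statement of `X` applied to a slice -/
lemma slice_nonneg (w : X → ℤ) (hw : ∀ D : Finset X, IsLowerSet (↑D : Set X) → 0 ≤ ∑ x ∈ D, w x)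
    (φ : X × B2 → ℕ∞) (hφ : Monotone φ) (y : B2) (m : ℕ∞) :
    0 ≤ ∑ x, (if φ (x, y) ≤ m then w x else 0) := by
  rw [← Finset.sum_filter]
  exact hw _ (slice_isLowerSet φ hφ y m)

omit [Fintype X] in
/-- a containment: a lower fibre is counted at least as often as a higher one -/
lemma indL_mono (φ : X × B2 → ℕ∞) (hφ : Monotone φ) (x : X) {y y' : B2} (hy : y' ≤ y) (m : ℕ∞) :
    indL (φ (x, y) ≤ m) ≤ indL (φ (x, y') ≤ m) := by
  unfold indL
  have hm : φ (x, y') ≤ φ (x, y) := hφ (Prod.mk_le_mk.2 ⟨le_rfl, hy⟩)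
  by_cases h1 : φ (x, y) ≤ m
  · have h2 : φ (x, y') ≤ m := hm.trans h1
    simp only [h1, h2, if_true]; exact le_rfl
  · simp only [h1, if_false]
    split_ifs <;> norm_num

/-- the sum over the four fibres -/
lemma sum_B2 (f : B2 → ℤ) : ∑ y, f y = f yo + f yB + f yA + f yt := by
  simp only [Fintype.sum_prod_type, Fintype.sum_bool, yo, yA, yB, yt]
  ring

/-- the statement part has non-negative total -/
lemma sum_certS_nonneg (hG : GDom 1 r b) (hV : VDom 2 r b) (hH : LevelHarris r b)
    (φ : X × B2 → ℕ∞) (hφ : Monotone φ) :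
    0 ≤ ∑ x, ∑ y, certS (r x) (b x) y (φ (x, y)) := by
  have h1 := slice_nonneg (fun x => gw 1 (r x) (b x)) hG φ hφ yo 1
  have h2 := slice_nonneg (fun x => vw 2 (r x) (b x)) hV φ hφ yB 2
  have h3 := slice_nonneg (fun x => hwOne (r x) (b x)) (sum_hwOne_nonneg r b hH) φ hφ yA 1
  have h4 := slice_nonneg (fun x => hwOne (r x) (b x)) (sum_hwOne_nonneg r b hH) φ hφ yB 1
  have e : ∀ x, ∑ y, certS (r x) (b x) y (φ (x, y))
      = (if φ (x, yo) ≤ 1 then gw 1 (r x) (b x) else 0) + (if φ (x, yB) ≤ 2 then vw 2 (r x) (b x) else 0)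
        + (if φ (x, yA) ≤ 1 then hwOne (r x) (b x) else 0) + (if φ (x, yB) ≤ 1 then hwOne (r x) (b x) else 0) := by
    intro x
    rw [sum_B2]
    simp only [certS, yo, yA, yB, yt, Prod.mk.injEq, Bool.false_eq_true, Bool.true_eq_false, and_self,
      and_false, false_and, true_and, if_false, add_zero, zero_add]
    ring
  simp only [e, Finset.sum_add_distrib]
  linarith

/-- the containment part has non-negative total -/
lemma sum_certC_nonneg (φ : X × B2 → ℕ∞) (hφ : Monotone φ) :
    0 ≤ ∑ x, ∑ y, certC (r x) (b x) y (φ (x, y)) := by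
  apply Finset.sum_nonneg
  intro x _
  rw [sum_B2]
  have hot : (yo : B2) ≤ yt := Prod.mk_le_mk.2 ⟨Bool.false_le _, Bool.false_le _⟩
  have hAt : (yA : B2) ≤ yt := Prod.mk_le_mk.2 ⟨le_rfl, Bool.false_le _⟩
  have hBt : (yB : B2) ≤ yt := Prod.mk_le_mk.2 ⟨Bool.false_le _, le_rfl⟩
  have i1 := indL_mono φ hφ x hot 1
  have i2 := indL_mono φ hφ x hBt 2
  have i3 := indL_mono φ hφ x hAt 1
  have i4 := indL_mono φ hφ x hAt 2
  have i5 := indL_mono φ hφ x hBt 2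
  have m1 : 0 ≤ mu1 (r x) (b x) := by unfold mu1; split_ifs <;> norm_num
  have m2 : 0 ≤ mu2 (r x) (b x) := by unfold mu2; split_ifs <;> norm_num
  have m3 : 0 ≤ mu3 (r x) (b x) := by unfold mu3; split_ifs <;> norm_num
  have m4 : 0 ≤ mu4 (r x) (b x) := by unfold mu4; split_ifs <;> norm_num
  simp only [certC, yo, yA, yB, yt, Prod.mk.injEq, Bool.false_eq_true, Bool.true_eq_false, and_self,
    and_false, false_and, true_and]
  simp only [indL, if_false, sub_zero, zero_sub, add_zero, zero_add, mul_zero, mul_neg] at i1 i2 i3 i4 i5 ⊢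
  nlinarith [mul_nonneg m1 (sub_nonneg.2 i1), mul_nonneg m2 (sub_nonneg.2 i2), mul_nonneg m3 (sub_nonneg.2 i3),
    mul_nonneg m4 (sub_nonneg.2 i4), mul_nonneg m4 (sub_nonneg.2 i5)]

/-- **the φ-inequality of the doubled network** -/
theorem phiIneq_doubling (hG : GDom 1 r b) (hV : VDom 2 r b) (hH : LevelHarris r b) :
    PhiIneq (dR r) (dB b) := by
  intro φ hφ
  have hsum : ∑ z, (certS (r z.1) (b z.1) z.2 (φ z) + certC (r z.1) (b z.1) z.2 (φ z))
      ≤ ∑ z, uw (dR r) (dB b) z (φ z) := Finset.sum_le_sum (fun z _ => cert_le r b z (φ z))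
  have hS := sum_certS_nonneg r b hG hV hH φ hφ
  have hC := sum_certC_nonneg r b φ hφ
  rw [Finset.sum_add_distrib, Fintype.sum_prod_type, Fintype.sum_prod_type] at hsum
  linarith

/-- **THEOREM (doubling in the critical context)**: if `X` carries `G_1`, `V2_2` and the level-1 Harris
inequality, the series product of `X` with a bundle of two parallel free edges satisfies the universal
level-conditioned Hall statement (UH*). -/
theorem universal_doubling (hG : GDom 1 r b) (hV : VDom 2 r b) (hH : LevelHarris r b) :
    Universal (dR r) (dB b) := by
  classical
  exact universal_of_phi (dR r) (dB b) (phiIneq_doubling r b hG hV hH)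

end doubling

end Summit.Ventures.PercRepro2.UHClosure
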